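import Summits.QuantumFields.YangMills.Theorems.UV3AxialLaunderingOverwritePropagate
import Summits.QuantumFields.YangMills.Theorems.UV3BranchExpansionDomination
import HarnessLib

/-!
# R3 (cell `ym3-torus`, YM₃ on T³ — a ladder RUNG, NOT d = 4, NOT infinite volume, NOT a mass gap, NOT the Clay problem) —
# **TRANSPORT OF A DEFECT ALONG A BRANCH: two laws that agree off a bond set `D` stay so under restriction to a `D`-blind event and push-forward by a
# map whose other coordinates do not read `D`; single-bond FRESHNESS (right-multiplying one coordinate leaves the law invariant) survives the same
# operations and climbs one level under a map axial at the bond above — the bookkeeping half of (M) in the level-by-level COUPLING form**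

Width seat `ym-ust-19936-w8` g12 on crux `stmt-QuantumFields-19936` `UnitScaleTilt.HistoryTailL` (`--supports`, helper; THEOREMS ONLY, 0 `def`, 0 `sorry`).
LEAD ★w1 g12's note `Cruxes/HistoryTailL/HTopBranchExpansion.md` §4 (M) «mute-element cancellation», in the form offered on the bus 03:44Z∕03:4xZ (w8 g12): along the
hybrid trajectory of a history the two BRANCH LAWS at a toggled site `σ = (k, c)` agree off `{c}` one level up; the agreement is TRANSPORTED up the tower (§1) until a
level whose segment through the tower keeps a FRESH slot, where ✓`UV3AxialLaunderingOverwrite.map_prod_eq_of_marginal_eq` makes the two laws EQUAL; freshness of the slot is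
itself transported up from product Haar (§2, over ✓`UV3AxialLaunderingOverwritePropagate.map_map_mulRight_mask_eq`); §3 is the level recursion of the branch measures
`μ_n := (dU_j ↾ {∀ i < n, V_i ∈ E_i}).map V_n` (LEAD's (A₃) computation, stated once).  The assembled theorem (M) is the sequel `UV3BranchExpansionMuteCoupling`.
RECORD CURRENCY (★★OWNER WORDS 84 (2) ∕ 85 (4) ∕ ACK 145): record-independent kinematics of product Haar and the straight transporter (any `Params`, any group with the lit
carrier instances); SUPPLY-side for the hTop-class rows `fibre55Win` ∕ `fibre57LowOn` of the χ record inside NODE O B3 and for Track A's N08 — NOT a 19936 registry row.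

CONTENTS ([folklore] measure theory; hypotheses are the consumable BLINDNESS letters `∀ U U′, (∀ b ∉ D, U b = U′ b) → …`).
* §1 `measure_eq_of_agreeOff_empty` · `map_eq_of_agreeOff` · ★ `agreeOff_map_restrict` (agree off `D` ⇒ restricted images agree off `D′`) · `agreeOff_map_restrict_of_maps`
  (ONE law, TWO maps agreeing off `D′` ⇒ restricted images agree off `D′` — the producer at the toggled site).
* §2 freshness at one bond `b` := `∀ g, ν.map (U ↦ U·𝟙_b(g)) = ν`: `fresh_fieldMeasure` · `fresh_restrict` · `extend_mask_singleton` (the `{C}`-masked slot shear IS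
  `𝟙_{line C (t C)}`) · ★ `shear_of_fresh` (freshness at the slot ⇒ the `hν` hypothesis of ✓`map_prod_eq_overwrite` for `Λ = {C}`) · ★★ `fresh_map_of_fresh` (freshness CLIMBS:
  fresh at a slot of `C`'s segment + `Φ` axial at `C`, other coordinates blind to the slot ⇒ `ν.map Φ` fresh at `C`).
* §3 `measurable_traj` · `map_restrict_traj_zero` · ★ `map_restrict_traj_succ` (`μ_{n+1} = ((μ_n) ↾ E_n).map T_n` at the gauge-field levels `j + n`).

HONEST SCOPE.  Bookkeeping; nothing of (M) itself (sequel), (C), hTop, (T8), (O‴χₛ), `HistoryTailL` (19936), the rung, d = 4, a mass gap or Clay is proved here.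
YM₃ on T³ is rung R3 of the ladder, not the Clay problem.

References: T. Bałaban, Commun. Math. Phys. **98** (1985) 17–51 [Balaban1985Averaging] ((10) p. 19 product Haar, (b) p. 23 Haar compatibility); T. Bałaban, Commun. Math.
Phys. **109** (1987) 249–301 [Balaban1987RG1] ((0.4) p. 253).
-/

set_option autoImplicit false

noncomputable section

open MeasureTheory Set Function
open scoped ENNReal

namespace Summit.QuantumFields.YangMills.Theorems.UV3BranchExpansionDefectTransport

open Literature.MathematicalPhysics.QuantumFieldTheory.Balaban1983to89
open Literature.MathematicalPhysics.QuantumFieldTheory.Balaban1983to89.AveragingRT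
open Summit.QuantumFields.YangMills.Theorems.UV3AxialLaunderingFreeSlot (line_inj extend_slot_apply)
open Summit.QuantumFields.YangMills.Theorems.UV3AxialLaunderingOverwrite (extend_mask_of_not_slot)
open Summit.QuantumFields.YangMills.Theorems.UV3AxialLaunderingOverwritePropagate (map_map_mulRight_mask_eq map_restrict_eq_of_map_eq)
open Summit.QuantumFields.YangMills.Theorems.UV3BranchExpansionDomination (measurable_iterate)

/-! ## §1 Two laws agreeing off a bond set -/
section AgreeOff

variable {P : Params} {i : ℕ} {G : Type*} [MeasurableSpace G] {Z : Type*} [MeasurableSpace Z]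

/-- Agreement off the EMPTY set is equality. [folklore] -/
theorem measure_eq_of_agreeOff_empty (ν₁ ν₂ : Measure (GaugeField P i G))
    (hagree : ∀ B : Set (GaugeField P i G), MeasurableSet B →
      (∀ U U' : GaugeField P i G, (∀ b, b ∉ (∅ : Set (PBond P i)) → U b = U' b) → (U ∈ B ↔ U' ∈ B)) → ν₁ B = ν₂ B) :
    ν₁ = ν₂ :=
  Measure.ext fun B hB => hagree B hB fun U U' h => by
    have hUU : U = U' := funext fun b => h b (Set.notMem_empty b)
    rw [hUU]

/-- **EQUAL `D`-BLIND MARGINALS**: two laws agreeing on every measurable `D`-blind set have the same image under every measurable `D`-blind map. [folklore] -/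
theorem map_eq_of_agreeOff (ν₁ ν₂ : Measure (GaugeField P i G)) (D : Set (PBond P i))
    (hagree : ∀ B : Set (GaugeField P i G), MeasurableSet B →
      (∀ U U' : GaugeField P i G, (∀ b, b ∉ D → U b = U' b) → (U ∈ B ↔ U' ∈ B)) → ν₁ B = ν₂ B)
    {ψ : GaugeField P i G → Z} (hψ : Measurable ψ) (hblind : ∀ U U' : GaugeField P i G, (∀ b, b ∉ D → U b = U' b) → ψ U = ψ U') :
    ν₁.map ψ = ν₂.map ψ := by
  ext B hB
  rw [Measure.map_apply hψ hB, Measure.map_apply hψ hB]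
  exact hagree _ (hψ hB) fun U U' h => by rw [Set.mem_preimage, Set.mem_preimage, hblind U U' h]

variable {i' : ℕ}

/-- ★ **THE DEFECT IS TRANSPORTED**: if `ν₁, ν₂` agree off `D`, the event `E` is `D`-blind, and every coordinate OUTSIDE `D′` of the measurable map `Φ` is `D`-blind, then the
restricted images `(ν₁↾E).map Φ`, `(ν₂↾E).map Φ` agree off `D′` (one level of the tower: `D = {t_n}`, `D′ = {t_{n+1}}`, the guard event and the EML outputs not reading
`t_n`). [folklore] -/
theorem agreeOff_map_restrict (ν₁ ν₂ : Measure (GaugeField P i G)) (D : Set (PBond P i)) (D' : Set (PBond P i'))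
    (hagree : ∀ B : Set (GaugeField P i G), MeasurableSet B →
      (∀ U U' : GaugeField P i G, (∀ b, b ∉ D → U b = U' b) → (U ∈ B ↔ U' ∈ B)) → ν₁ B = ν₂ B)
    {E : Set (GaugeField P i G)} (hE : MeasurableSet E)
    (hEblind : ∀ U U' : GaugeField P i G, (∀ b, b ∉ D → U b = U' b) → (U ∈ E ↔ U' ∈ E))
    {Φ : GaugeField P i G → GaugeField P i' G} (hΦ : Measurable Φ)
    (hΦblind : ∀ U U' : GaugeField P i G, (∀ b, b ∉ D → U b = U' b) → ∀ c, c ∉ D' → Φ U c = Φ U' c) :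
    ∀ B : Set (GaugeField P i' G), MeasurableSet B →
      (∀ W W' : GaugeField P i' G, (∀ c, c ∉ D' → W c = W' c) → (W ∈ B ↔ W' ∈ B)) →
        ((ν₁.restrict E).map Φ) B = ((ν₂.restrict E).map Φ) B := by
  intro B hB hBblind
  rw [Measure.map_apply hΦ hB, Measure.map_apply hΦ hB, Measure.restrict_apply (hΦ hB), Measure.restrict_apply (hΦ hB)]
  refine hagree _ ((hΦ hB).inter hE) fun U U' h => ?_
  rw [Set.mem_inter_iff, Set.mem_inter_iff, Set.mem_preimage, Set.mem_preimage, hBblind (Φ U) (Φ U') (hΦblind U U' h), hEblind U U' h]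

/-- **THE PRODUCER AT THE TOGGLED SITE**: ONE law, TWO measurable maps agreeing at every coordinate outside `D′` — the restricted images agree off `D′` (the EML branch and
the axial branch at `c` differ only at the coordinate `c`). [folklore] -/
theorem agreeOff_map_restrict_of_maps (ν : Measure (GaugeField P i G)) (D' : Set (PBond P i')) (E : Set (GaugeField P i G))
    {Φ₁ Φ₂ : GaugeField P i G → GaugeField P i' G} (hΦ₁ : Measurable Φ₁) (hΦ₂ : Measurable Φ₂)
    (hmaps : ∀ U, ∀ c, c ∉ D' → Φ₁ U c = Φ₂ U c) :
    ∀ B : Set (GaugeField P i' G), MeasurableSet B →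
      (∀ W W' : GaugeField P i' G, (∀ c, c ∉ D' → W c = W' c) → (W ∈ B ↔ W' ∈ B)) →
        ((ν.restrict E).map Φ₁) B = ((ν.restrict E).map Φ₂) B := by
  intro B hB hBblind
  rw [Measure.map_apply hΦ₁ hB, Measure.map_apply hΦ₂ hB]
  have hpre : Φ₁ ⁻¹' B = Φ₂ ⁻¹' B := Set.ext fun U => by
    rw [Set.mem_preimage, Set.mem_preimage]; exact hBblind _ _ (hmaps U)
  rw [hpre]

end AgreeOff

/-! ## §2 Freshness at one bond and how it climbs -/
section Fresh

variable {P : Params} {i : ℕ} {G : Type*} [GaugeGroup G] [MeasurableSpace G] [HaarData G] [MeasurableMul₂ G]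

/-- Product Haar is fresh at every bond. [cite: Balaban1985Averaging, (10) p.19] -/
theorem fresh_fieldMeasure (b : PBond P i) (g : G) :
    (fieldMeasure P i G).map (fun (U : GaugeField P i G) (b' : PBond P i) => U b' * ({b} : Set (PBond P i)).mulIndicator (fun _ => g) b') =
      fieldMeasure P i G :=
  (measurePreserving_mulRight _).map_eq

/-- **FRESHNESS SURVIVES RESTRICTION TO A `b`-BLIND EVENT.** [folklore] -/
theorem fresh_restrict (ν : Measure (GaugeField P i G)) (b : PBond P i)
    (hν : ∀ g : G, ν.map (fun (U : GaugeField P i G) (b' : PBond P i) => U b' * ({b} : Set (PBond P i)).mulIndicator (fun _ => g) b') = ν)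
    {E : Set (GaugeField P i G)} (hE : MeasurableSet E)
    (hEblind : ∀ U U' : GaugeField P i G, (∀ b', b' ≠ b → U b' = U' b') → (U ∈ E ↔ U' ∈ E)) (g : G) :
    (ν.restrict E).map (fun (U : GaugeField P i G) (b' : PBond P i) => U b' * ({b} : Set (PBond P i)).mulIndicator (fun _ => g) b') =
      ν.restrict E := by
  refine map_restrict_eq_of_map_eq (measurePreserving_mulRight _).measurable (hν g) hE (Set.ext fun U => ?_)
  rw [Set.mem_preimage]
  refine hEblind _ _ fun b' hb' => ?_
  rw [Set.mulIndicator_of_notMem (show b' ∉ ({b} : Set (PBond P i)) from hb'), mul_one]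

variable {j : ℕ}

omit [MeasurableSpace G] [HaarData G] [MeasurableMul₂ G] in
/-- **THE `{C}`-MASKED SLOT SHEAR IS THE ONE-BOND MULTIPLIER AT THE SLOT OF `C`.** [folklore] -/
theorem extend_mask_singleton (hj : j + 1 ≤ P.m + P.K) (t : PBond P (j + 1) → ℕ) (ht : ∀ c, t c < P.L) (C : PBond P (j + 1))
    (k : GaugeField P (j + 1) G) :
    Function.extend (fun c : PBond P (j + 1) => line c (t c)) (({C} : Set (PBond P (j + 1))).mulIndicator k) (fun _ => 1) =
      ({line C (t C)} : Set (PBond P j)).mulIndicator (fun _ => k C) := by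
  funext b'
  by_cases hb : ∃ c : PBond P (j + 1), line c (t c) = b'
  · obtain ⟨c, rfl⟩ := hb
    rw [extend_slot_apply hj t ht]
    by_cases hc : c = C
    · subst hc
      rw [Set.mulIndicator_of_mem (Set.mem_singleton _), Set.mulIndicator_of_mem (Set.mem_singleton _)]
    · rw [Set.mulIndicator_of_notMem (show c ∉ ({C} : Set (PBond P (j + 1))) from hc), Set.mulIndicator_of_notMem]
      intro h
      exact hc (line_inj hj (ht c) (ht C) (Set.mem_singleton_iff.1 h)).1
  · rw [Function.extend_apply' _ _ _ hb, Set.mulIndicator_of_notMem]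
    intro h
    exact hb ⟨C, (Set.mem_singleton_iff.1 h).symm⟩

omit [HaarData G] [MeasurableMul₂ G] in
/-- ★ **FRESHNESS AT THE SLOT GIVES THE SHEAR HYPOTHESIS OF THE OVERWRITE FORMULA FOR `Λ = {C}`.** [folklore] -/
theorem shear_of_fresh (hj : j + 1 ≤ P.m + P.K) (t : PBond P (j + 1) → ℕ) (ht : ∀ c, t c < P.L) (C : PBond P (j + 1))
    (ν : Measure (GaugeField P j G))
    (hν : ∀ g : G, ν.map (fun (U : GaugeField P j G) (b' : PBond P j) =>
      U b' * ({line C (t C)} : Set (PBond P j)).mulIndicator (fun _ => g) b') = ν) :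
    ∀ k : GaugeField P (j + 1) G,
      ν.map (fun (U : GaugeField P j G) (b' : PBond P j) =>
        U b' * Function.extend (fun c : PBond P (j + 1) => line c (t c)) (({C} : Set (PBond P (j + 1))).mulIndicator k) (fun _ => 1) b') = ν := by
  intro k
  rw [extend_mask_singleton hj t ht C k]
  exact hν (k C)

/-- ★★ **FRESHNESS CLIMBS ONE LEVEL**: `ν` s-finite and fresh at the slot `line C (t C)` of the segment of `C`; `Φ` measurable, EQUAL to the straight transporter at the
coordinate `C`, its other coordinates blind to that slot.  Then `ν.map Φ` is fresh at `C` (✓`map_map_mulRight_mask_eq` at `Λ = {C}`). [cite: Balaban1985Averaging, (b) p.23] -/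
theorem fresh_map_of_fresh (hj : j + 1 ≤ P.m + P.K) (t : PBond P (j + 1) → ℕ) (ht : ∀ c, t c < P.L) (C : PBond P (j + 1))
    (ν : Measure (GaugeField P j G)) [SFinite ν]
    (hν : ∀ g : G, ν.map (fun (U : GaugeField P j G) (b' : PBond P j) =>
      U b' * ({line C (t C)} : Set (PBond P j)).mulIndicator (fun _ => g) b') = ν)
    {Φ : GaugeField P j G → GaugeField P (j + 1) G} (hΦ : Measurable Φ) (hΦC : ∀ U, Φ U C = axialAvg U C)
    (hΦoff : ∀ U U' : GaugeField P j G, (∀ b', b' ≠ line C (t C) → U b' = U' b') → ∀ c, c ≠ C → Φ U c = Φ U' c) (g : G) :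
    (ν.map Φ).map (fun (V : GaugeField P (j + 1) G) (c : PBond P (j + 1)) => V c * ({C} : Set (PBond P (j + 1))).mulIndicator (fun _ => g) c) =
      ν.map Φ := by
  classical
  have hΦΛ : ∀ U, ∀ c ∈ ({C} : Set (PBond P (j + 1))), Φ U c = axialAvg U c := fun U c hc => by
    rw [Set.mem_singleton_iff.1 hc]; exact hΦC U
  have hΦoff' : ∀ U U' : GaugeField P j G, (∀ b, (¬ ∃ c ∈ ({C} : Set (PBond P (j + 1))), line c (t c) = b) → U b = U' b) →
      ∀ c, c ∉ ({C} : Set (PBond P (j + 1))) → Φ U c = Φ U' c := by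
    intro U U' h c hc
    refine hΦoff U U' (fun b' hb' => h b' ?_) c hc
    rintro ⟨c', hc', rfl⟩
    exact hb' (by rw [Set.mem_singleton_iff.1 hc'])
  exact map_map_mulRight_mask_eq hj t ht ({C} : Set (PBond P (j + 1))) hΦ hΦΛ hΦoff' ν (shear_of_fresh hj t ht C ν hν) (fun _ => g)

end Fresh

/-! ## §3 The level recursion of the branch measures (gauge-field levels `j + n`) -/
section Recursion

variable {P : Params} {j : ℕ} {G : Type*} [MeasurableSpace G]
  (lam0 : Measure (GaugeField P j G)) (T : (n : ℕ) → GaugeField P (j + n) G → GaugeField P (j + n + 1) G)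
  (E : (n : ℕ) → Set (GaugeField P (j + n) G)) (V : (n : ℕ) → GaugeField P j G → GaugeField P (j + n) G)

/-- The trajectory of measurable one-step maps is measurable at every height (LEAD's ✓`measurable_iterate` at the gauge-field levels; stated with the domain
`GaugeField P j G` verbatim so that it rewrites). [folklore] -/
theorem measurable_traj (hT : ∀ n, Measurable (T n)) (hV0 : ∀ U, V 0 U = U) (hVs : ∀ n U, V (n + 1) U = T n (V n U)) :
    ∀ n, Measurable (V n) :=
  measurable_iterate (X := fun n => GaugeField P (j + n) G) T V hT hV0 hVs

/-- At height `0` the branch measure is the input law. [folklore] -/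
theorem map_restrict_traj_zero (hV0 : ∀ U, V 0 U = U) :
    (lam0.restrict {U : GaugeField P j G | ∀ i < 0, V i U ∈ E i}).map (V 0) = lam0 := by
  have h : V 0 = id := funext hV0
  have hset : {U : GaugeField P j G | ∀ i < 0, V i U ∈ E i} = univ := eq_univ_of_forall fun U i hi => absurd hi (Nat.not_lt_zero i)
  rw [hset, Measure.restrict_univ, h, Measure.map_id]

/-- ★ **THE LEVEL RECURSION**: `μ_{n+1} = ((μ_n) ↾ E_n).map T_n` for `μ_n := (λ₀ ↾ {∀ i < n, V_i ∈ E_i}).map V_n` along `V_{n+1} = T_n ∘ V_n` (LEAD's (A₃) computation,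
stated once at the gauge-field levels). [folklore] -/
theorem map_restrict_traj_succ (hT : ∀ n, Measurable (T n)) (hE : ∀ n, MeasurableSet (E n)) (hV0 : ∀ U, V 0 U = U)
    (hVs : ∀ n U, V (n + 1) U = T n (V n U)) (n : ℕ) :
    (lam0.restrict {U : GaugeField P j G | ∀ i < n + 1, V i U ∈ E i}).map (V (n + 1)) =
      (((lam0.restrict {U : GaugeField P j G | ∀ i < n, V i U ∈ E i}).map (V n)).restrict (E n)).map (T n) := by
  have hVm : ∀ n, Measurable (V n) := measurable_traj T V hT hV0 hVs
  have hset : {U : GaugeField P j G | ∀ i < n + 1, V i U ∈ E i} = V n ⁻¹' E n ∩ {U : GaugeField P j G | ∀ i < n, V i U ∈ E i} := by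
    ext U
    simp only [mem_setOf_eq, mem_inter_iff, mem_preimage]
    constructor
    · intro h
      exact ⟨h n (Nat.lt_succ_self n), fun i hi => h i (Nat.lt_succ_of_lt hi)⟩
    · rintro ⟨hn, h⟩ i hi
      rcases Nat.lt_succ_iff_lt_or_eq.1 hi with hi' | rfl
      · exact h i hi'
      · exact hn
  have hcomp : V (n + 1) = T n ∘ V n := funext (hVs n)
  rw [hset, ← Measure.restrict_restrict (hVm n (hE n)), hcomp, ← Measure.map_map (hT n) (hVm n),
    ← Measure.restrict_map (hVm n) (hE n)]

end Recursion

end Summit.QuantumFields.YangMills.Theorems.UV3BranchExpansionDefectTransport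

end
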